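import Summits.NavierStokesRegularity.FluidComputer.GateBudgetColdPhase
import HarnessLib

/-!
# What no tuning can beat, part 58: THE COLD PHASE AGAINST THE CLOCK ACTION — on the window
# where the trigger of a headline member sits below `ρ²/K⁹` after a dousing at clock `-θε` with
# output pair `P₀`, the clock is strictly increasing with increments in `ε[s_l, s_u](t - s)`
# (`s_l = 1 - P₀ - 8/K⁹`, `s_u = 1 - P₀ + 6/K⁹`), its action `B` (`B' = b`) is pinned between
# the two parabolas `ε(t - T)(s(t - T)/2 - θ)` from `T` and `εs(t - tz)²/2` about its zero `tz`,
# and the trigger CANNOT relight before the clock zero (it is `≤ c(T) + 3σ`), nor after it while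
# the debt is unpaid (`B ≤ B(T)`) and `s_u(t - tz)²/2 ≤ 1 - 10 log K/K¹⁰` (it is
# `≤ c(T) + 3ρ²/K¹⁰`) — the lower half of law 4″ of the θ-drift audit (SPEC-INPUT-bp1 §AZ/§BA)

Cell `pub-fluidc`, blueprint seat bp1 (gen 35, first item); same namespace and conventions as
parts 1–57 (`GateBudget*.lean`); imports part 57 (`GateBudgetColdPhase`: §171 `cold_numerics`,
§172 `knob_cold_brackets`; hence part 56's bricks `clock_bracket`, `trigger_debt`). Headline knob
family `rotorCircuit K K¹⁰ ε ρ` (`σ = ρ²e^{-K¹⁰}`, `μ = ε⁻¹K¹⁰`, `R = ρ⁻²`; modes `0 = a` carrier,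
`1 = b` clock, `2 = c` trigger, `3 = d`, `4 = ã`). HONEST FRAMING (verbatim): low prior, high
value-of-information experiment on Tao's machine paradigm; NOT a claim that NS blows up. Nothing
is proved about the Navier–Stokes equations.

## Why (SPEC-INPUT-bp1 §BA: law 4″ is bracket algebra against ONE clock action)

Part 57 pins the cold phase two-sidedly: on any window `[T, u]` (`u ≤ T + 3`) on which
`c ≤ ρ²/K⁹`, the carrier is `a² ∈ [s_l + 1/K⁹, s_u]` and the clock obeys
`-θε + εs_l(t - T) ≤ b ≤ -θε + εs_u(t - T)`. The relight time is governed by the trigger's two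
exponential laws of part 56 against the clock ACTION `B = ∫ b`: the memory law
`c(t) ≥ c(s)e^{μ(B(t) - B(s))}` (§169) and the debt law
`c(t) ≤ (c(s) + σE(t - s))e^{μ(B(t) - B(s))}` (§170, `E` a bound for `e^{μ(B(s) - B(τ))}`).
Everything therefore reduces to two-sided POLYNOMIAL bounds on `B`, which this file supplies,
and to two "quiet" laws (no relight yet): before the clock zero the minimum of `B` on `[T, t]`
is `B(t)` itself, so `E·e^{μ(B(t) - B(T))} = 1` and `c(t) ≤ c(T) + σ(t - T)`; after the clock
zero the minimum is `B(tz)` and the seed term is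
`σ(t - T)e^{μ(B(t) - B(tz))} ≤ 3σe^{K¹⁰s_u(t - tz)²/2} ≤ 3ρ²/K¹⁰` as long as
`s_u(t - tz)²/2 ≤ 1 - 10 log K/K¹⁰`, while the memory term `c(T)e^{μ(B(t) - B(T))} ≤ c(T)` as
long as the debt is unpaid (`B(t) ≤ B(T)`, in particular for `t - T ≤ 2θ/s_u`).

## What is proved (every constant carried as `c/K⁹`, nothing rounded to an absolute number)

Common hypotheses (those of part 57 §172): a member from `delayInit`, `K ≥ 16`, `0 < ε`,
`ε² ≤ 1/(6K²⁰)`, `0 < ρ`, `K¹⁰ρ² ≤ 2ε`; `T ≥ 0`, `b(T) = -θε` (`0 ≤ θ ≤ 3/2`),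
`P₀ = d(T)² + ã(T)²`; a window `[T, u]`, `u ≤ T + 3`, on which `c ≤ ρ²/K⁹`; and `P₀ ≤ 1/2`
where the sign of `s_l` matters.
* §174 `cold_slopes` — `8/K⁹, 6/K⁹ ≤ 2⁻³³` and `s_l > 0` for `P₀ ≤ 1/2`; `knob_cold_clock_mono` —
  the clock is strictly increasing on `[T, u]`.
* §175 `knob_cold_increment` — `εs_l(t - s) ≤ b(t) - b(s) ≤ εs_u(t - s)` for `T ≤ s ≤ t ≤ u`.
* §176 `knob_cold_action` — for any action `B` (`B' = b`) and `t ∈ [T, u]`: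
  `ε(t - T)(s_l(t - T)/2 - θ) ≤ B(t) - B(T) ≤ ε(t - T)(s_u(t - T)/2 - θ)`.
* §177 `knob_cold_zero_action` — if `tz ∈ [T, u]` is the clock zero: for `t ∈ [T, u]`,
  `εs_l(t - tz)²/2 ≤ B(t) - B(tz) ≤ εs_u(t - tz)²/2` (both sides of `tz`),
  `εs_l(t - tz) ≤ b(t) ≤ εs_u(t - tz)` for `t ≥ tz`, and `b(t) ≤ 0` for `t ≤ tz`.
* §178 `knob_cold_quiet` — QUIET BEFORE THE ZERO: if `b(t) ≤ 0` then `c(t) ≤ c(T) + 3σ`.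
* §179 `knob_cold_quiet_seed` — QUIET AFTER THE ZERO WHILE IN DEBT: if `B(t) ≤ B(T)` and
  `s_u(t - tz)²/2 ≤ 1 - 10 log K/K¹⁰` then `c(t) ≤ c(T) + 3ρ²/K¹⁰`.

With `c(T) ≤ 2ρ²/K¹⁰` both quiet bounds are `≤ 5ρ²/K¹⁰ < ρ²/K⁹`: the relight waits for the debt
(`t - T > 2θ/s_u`) or for the seed (`s_u(t - tz)²/2 > 1 - 10 log K/K¹⁰`). The matching UPPER
bounds on the relight time and the assembled law 4″ are part 59 (`GateBudgetRelight`).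
-/

noncomputable section

namespace Summit.NavierStokesRegularity.FluidComputer.GateBudget

open Real Set
open Literature.Analysis.FluidPDE.Tao2016AveragedNS

variable {K ε ρ : ℝ} {X : ℝ → Fin 5 → ℝ}

/-! ## §174 The slopes, and the clock is strictly increasing -/

/-- §174 THE COLD SLOPES at `K ≥ 16`, `P₀ ≤ 1/2`: `8/K⁹ ≤ 2⁻³³`, `0 ≤ 6/K⁹ ≤ 2⁻³³`, and
`s_l = 1 - P₀ - 8/K⁹ > 0`. [derived: this file §174] -/
theorem cold_slopes (hK : 16 ≤ K) {P₀ : ℝ} (hP0 : P₀ ≤ 1 / 2) :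
    8 / K ^ 9 ≤ 1 / 8589934592 ∧ 0 ≤ 6 / K ^ 9 ∧ 6 / K ^ 9 ≤ 1 / 8589934592 ∧
      0 < 1 - P₀ - 8 / K ^ 9 := by
  have hK0 : (0 : ℝ) < K := by linarith
  have hK9 : (0 : ℝ) < K ^ 9 := by positivity
  have h9 : (16 : ℝ) ^ 9 ≤ K ^ 9 := pow_le_pow_left₀ (by norm_num) hK 9
  have h8 : 8 / K ^ 9 ≤ 1 / 8589934592 := by
    rw [div_le_div_iff₀ hK9 (by norm_num)]; nlinarith [h9]
  have h6 : 6 / K ^ 9 ≤ 1 / 8589934592 := by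
    rw [div_le_div_iff₀ hK9 (by norm_num)]; nlinarith [h9]
  exact ⟨h8, by positivity, h6, by linarith⟩

/-- §174 THE COLD CLOCK IS STRICTLY INCREASING: under part 57 §172's hypotheses with `P₀ ≤ 1/2`,
`b' = εa² - μc² ≥ ε(s_l + 1/K⁹) - ε/K⁹ > 0` on `[T, u]`. [derived: this file §174] -/
theorem knob_cold_clock_mono
    (hX : ∀ t, HasDerivAt X (RotorKnob.rotorCircuit K (K ^ 10) ε ρ (X t)) t)
    (h0 : X 0 = delayInit) (hK : 16 ≤ K) (hε : 0 < ε) (hεK : ε ^ 2 ≤ 1 / (6 * K ^ 20))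
    (hρ : 0 < ρ) (hhi : K ^ 10 * ρ ^ 2 ≤ 2 * ε) {T u θ P₀ : ℝ} (hT : 0 ≤ T)
    (hu : u ≤ T + 3) (hθ : 0 ≤ θ) (hθ2 : θ ≤ 3 / 2) (hbT : X T 1 = -(θ * ε))
    (hP : X T 3 ^ 2 + X T 4 ^ 2 = P₀) (hc : ∀ t ∈ Icc T u, X t 2 ≤ ρ ^ 2 / K ^ 9)
    (hP0 : P₀ ≤ 1 / 2) : StrictMonoOn (fun s => X s 1) (Icc T u) := by
  have hK0 : (0 : ℝ) < K := by linarith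
  have hsl := (cold_slopes hK hP0).2.2.2
  have hbr := fun r (hr : r ∈ Icc T u) =>
    (knob_cold_brackets hX h0 hK hε hεK hρ hhi hT hu hθ hθ2 hbT hP hc hr).2.1
  obtain ⟨_, n2⟩ := cold_numerics hK hε hεK hρ hhi
  have hXf := hX
  rw [RotorKnob.rotorCircuit_eq_fiveGate] at hXf
  have hσ : (0 : ℝ) ≤ ρ ^ 2 * exp (-K ^ 10) := by positivity
  refine strictMonoOn_of_deriv_pos (convex_Icc T u) (continuous_traj hXf 1).continuousOn
    fun r hr => ?_
  rw [interior_Icc] at hr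
  have hr' : r ∈ Icc T u := Ioo_subset_Icc_self hr
  rw [(hasDerivAt_b hXf r).deriv]
  have ha := (hbr r hr').1
  have hc0 : 0 ≤ X r 2 := c_nonneg hXf h0 hσ (hT.trans hr'.1)
  have hc2 : X r 2 ^ 2 ≤ (ρ ^ 2 / K ^ 9) ^ 2 := pow_le_pow_left₀ hc0 (hc r hr') 2
  have hdrag : ε⁻¹ * K ^ 10 * X r 2 ^ 2 ≤ ε / K ^ 9 :=
    (mul_le_mul_of_nonneg_left hc2 (by positivity)).trans n2
  have hpos : 0 < ε * (1 - P₀ - 8 / K ^ 9) := mul_pos hε hsl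
  have e : ε * (1 - P₀ - 8 / K ^ 9) = ε * (1 - P₀ - 7 / K ^ 9) - ε / K ^ 9 := by ring
  nlinarith [mul_le_mul_of_nonneg_left ha hε.le, hdrag, hpos, e]

/-! ## §175 Clock increments on the cold window -/

/-- §175 THE CLOCK INCREMENT LAW: under part 57 §172's hypotheses, for `T ≤ s ≤ t ≤ u`,
`εs_l(t - s) ≤ b(t) - b(s) ≤ εs_u(t - s)` (`s_l = 1 - P₀ - 8/K⁹`, `s_u = 1 - P₀ + 6/K⁹`: the
carrier bracket `[s_l + 1/K⁹, s_u]` and the drag `μc² ≤ ε/K⁹`, part 56 §168).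
[derived: this file §175] -/
theorem knob_cold_increment
    (hX : ∀ t, HasDerivAt X (RotorKnob.rotorCircuit K (K ^ 10) ε ρ (X t)) t)
    (h0 : X 0 = delayInit) (hK : 16 ≤ K) (hε : 0 < ε) (hεK : ε ^ 2 ≤ 1 / (6 * K ^ 20))
    (hρ : 0 < ρ) (hhi : K ^ 10 * ρ ^ 2 ≤ 2 * ε) {T u θ P₀ : ℝ} (hT : 0 ≤ T)
    (hu : u ≤ T + 3) (hθ : 0 ≤ θ) (hθ2 : θ ≤ 3 / 2) (hbT : X T 1 = -(θ * ε))
    (hP : X T 3 ^ 2 + X T 4 ^ 2 = P₀) (hc : ∀ t ∈ Icc T u, X t 2 ≤ ρ ^ 2 / K ^ 9)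
    {s t : ℝ} (hs : s ∈ Icc T u) (ht : t ∈ Icc T u) (hst : s ≤ t) :
    ε * (1 - P₀ - 8 / K ^ 9) * (t - s) ≤ X t 1 - X s 1 ∧
      X t 1 - X s 1 ≤ ε * (1 - P₀ + 6 / K ^ 9) * (t - s) := by
  have hK0 : (0 : ℝ) < K := by linarith
  have hbr := fun r (hr : r ∈ Icc T u) =>
    (knob_cold_brackets hX h0 hK hε hεK hρ hhi hT hu hθ hθ2 hbT hP hc hr).2.1
  obtain ⟨_, n2⟩ := cold_numerics hK hε hεK hρ hhi
  have hXf := hX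
  rw [RotorKnob.rotorCircuit_eq_fiveGate] at hXf
  have hσ : (0 : ℝ) ≤ ρ ^ 2 * exp (-K ^ 10) := by positivity
  have hμ : (0 : ℝ) ≤ ε⁻¹ * K ^ 10 := by positivity
  have hc2 : ∀ r ∈ Icc T u, X r 2 ^ 2 ≤ (ρ ^ 2 / K ^ 9) ^ 2 := fun r hr =>
    pow_le_pow_left₀ (c_nonneg hXf h0 hσ (hT.trans hr.1)) (hc r hr) 2
  obtain ⟨hl, hu'⟩ := clock_bracket hXf hε.le hμ hbr hc2 hs ht hst
  have hdrag : ε⁻¹ * K ^ 10 * (ρ ^ 2 / K ^ 9) ^ 2 * (t - s) ≤ ε / K ^ 9 * (t - s) :=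
    mul_le_mul_of_nonneg_right n2 (sub_nonneg.2 hst)
  have e : ε * (1 - P₀ - 8 / K ^ 9) * (t - s)
      = ε * (1 - P₀ - 7 / K ^ 9) * (t - s) - ε / K ^ 9 * (t - s) := by ring
  have e' : (ε * (1 - P₀ - 7 / K ^ 9) - ε⁻¹ * K ^ 10 * (ρ ^ 2 / K ^ 9) ^ 2) * (t - s)
      = ε * (1 - P₀ - 7 / K ^ 9) * (t - s) - ε⁻¹ * K ^ 10 * (ρ ^ 2 / K ^ 9) ^ 2 * (t - s) := by
    ring
  exact ⟨by linarith [hl, hdrag, e, e'], hu'⟩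

/-! ## §176 The clock action from the dousing time -/

/-- §176 THE CLOCK ACTION FROM `T`: under part 57 §172's hypotheses, any action `B` (`B' = b`)
satisfies `ε(t - T)(s_l(t - T)/2 - θ) ≤ B(t) - B(T) ≤ ε(t - T)(s_u(t - T)/2 - θ)` on `[T, u]`
(integrate the clock bracket). In particular the debt `B(T) - B(t)` is repaid no earlier than
`t - T = 2θ/s_u` and no later than `2θ/s_l`. [derived: this file §176] -/
theorem knob_cold_action
    (hX : ∀ t, HasDerivAt X (RotorKnob.rotorCircuit K (K ^ 10) ε ρ (X t)) t)
    (h0 : X 0 = delayInit) (hK : 16 ≤ K) (hε : 0 < ε) (hεK : ε ^ 2 ≤ 1 / (6 * K ^ 20))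
    (hρ : 0 < ρ) (hhi : K ^ 10 * ρ ^ 2 ≤ 2 * ε) {T u θ P₀ : ℝ} (hT : 0 ≤ T)
    (hu : u ≤ T + 3) (hθ : 0 ≤ θ) (hθ2 : θ ≤ 3 / 2) (hbT : X T 1 = -(θ * ε))
    (hP : X T 3 ^ 2 + X T 4 ^ 2 = P₀) (hc : ∀ t ∈ Icc T u, X t 2 ≤ ρ ^ 2 / K ^ 9)
    {B : ℝ → ℝ} (hB : ∀ t, HasDerivAt B (X t 1) t) {t : ℝ} (ht : t ∈ Icc T u) :
    ε * ((t - T) * ((1 - P₀ - 8 / K ^ 9) * (t - T) / 2 - θ)) ≤ B t - B T ∧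
      B t - B T ≤ ε * ((t - T) * ((1 - P₀ + 6 / K ^ 9) * (t - T) / 2 - θ)) := by
  have hcl := fun r (hr : r ∈ Icc T u) =>
    (knob_cold_brackets hX h0 hK hε hεK hρ hhi hT hu hθ hθ2 hbT hP hc hr).2.2
  -- `Φ_s(r) = ε(r - T)(s(r - T)/2 - θ)` has `Φ_s' = -θε + εs(r - T)`
  have hΦ : ∀ s r : ℝ, HasDerivAt (fun r => ε * ((r - T) * (s * (r - T) / 2 - θ)))
      (-(θ * ε) + ε * s * (r - T)) r := by
    intro s r
    have h1 : HasDerivAt (fun r => r - T) 1 r := (hasDerivAt_id r).sub_const T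
    exact ((h1.mul (((h1.const_mul s).div_const 2).sub_const θ)).const_mul ε).congr_deriv
      (by ring)
  have hTu : T ≤ u := ht.1.trans ht.2
  have hTI : T ∈ Icc T u := left_mem_Icc.2 hTu
  constructor
  · have hm := Thm53.monotoneOn_sub_of_le_deriv (convex_Icc T u) (fun r _ => hB r)
      (fun r _ => hΦ (1 - P₀ - 8 / K ^ 9) r) (fun r hr => (hcl r hr).1)
    have h := hm hTI ht ht.1
    simp only [sub_self, zero_mul, mul_zero, sub_zero] at h
    linarith
  · have hm := Thm53.antitoneOn_sub_of_deriv_le (convex_Icc T u) (fun r _ => hB r)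
      (fun r _ => hΦ (1 - P₀ + 6 / K ^ 9) r) (fun r hr => (hcl r hr).2)
    have h := hm hTI ht ht.1
    simp only [sub_self, zero_mul, mul_zero, sub_zero] at h
    linarith

/-! ## §177 The clock and its action about the clock zero -/

/-- §177 THE CLOCK ACTION ABOUT THE ZERO: under part 57 §172's hypotheses with `P₀ ≤ 1/2`, if
`tz ∈ [T, u]` is the clock zero (`b(tz) = 0`) then for every `t ∈ [T, u]` (on BOTH sides of
`tz`) `εs_l(t - tz)²/2 ≤ B(t) - B(tz) ≤ εs_u(t - tz)²/2`; for `t ≥ tz` the re-armed clock is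
`εs_l(t - tz) ≤ b(t) ≤ εs_u(t - tz)`; and `b ≤ 0` on `[T, tz]`. [derived: this file §177] -/
theorem knob_cold_zero_action
    (hX : ∀ t, HasDerivAt X (RotorKnob.rotorCircuit K (K ^ 10) ε ρ (X t)) t)
    (h0 : X 0 = delayInit) (hK : 16 ≤ K) (hε : 0 < ε) (hεK : ε ^ 2 ≤ 1 / (6 * K ^ 20))
    (hρ : 0 < ρ) (hhi : K ^ 10 * ρ ^ 2 ≤ 2 * ε) {T u θ P₀ : ℝ} (hT : 0 ≤ T)
    (hu : u ≤ T + 3) (hθ : 0 ≤ θ) (hθ2 : θ ≤ 3 / 2) (hbT : X T 1 = -(θ * ε))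
    (hP : X T 3 ^ 2 + X T 4 ^ 2 = P₀) (hc : ∀ t ∈ Icc T u, X t 2 ≤ ρ ^ 2 / K ^ 9)
    (hP0 : P₀ ≤ 1 / 2) {B : ℝ → ℝ} (hB : ∀ t, HasDerivAt B (X t 1) t) {tz : ℝ}
    (htz : tz ∈ Icc T u) (hz : X tz 1 = 0) {t : ℝ} (ht : t ∈ Icc T u) :
    (ε * (1 - P₀ - 8 / K ^ 9) * (t - tz) ^ 2 / 2 ≤ B t - B tz ∧
        B t - B tz ≤ ε * (1 - P₀ + 6 / K ^ 9) * (t - tz) ^ 2 / 2) ∧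
      (tz ≤ t → ε * (1 - P₀ - 8 / K ^ 9) * (t - tz) ≤ X t 1 ∧
        X t 1 ≤ ε * (1 - P₀ + 6 / K ^ 9) * (t - tz)) ∧
      (t ≤ tz → X t 1 ≤ 0) := by
  have hsl := (cold_slopes hK hP0).2.2.2
  have hinc := fun s (hs : s ∈ Icc T u) r (hr : r ∈ Icc T u) (hsr : s ≤ r) =>
    knob_cold_increment hX h0 hK hε hεK hρ hhi hT hu hθ hθ2 hbT hP hc hs hr hsr
  -- the clock about `tz`: `ε s_l (r - tz) ≤ b ≤ ε s_u (r - tz)` after, reversed before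
  have hafter : ∀ r ∈ Icc T u, tz ≤ r → ε * (1 - P₀ - 8 / K ^ 9) * (r - tz) ≤ X r 1 ∧
      X r 1 ≤ ε * (1 - P₀ + 6 / K ^ 9) * (r - tz) := by
    intro r hr hzr
    have h := hinc tz htz r hr hzr
    rwa [hz, sub_zero] at h
  have hbefore : ∀ r ∈ Icc T u, r ≤ tz → ε * (1 - P₀ + 6 / K ^ 9) * (r - tz) ≤ X r 1 ∧
      X r 1 ≤ ε * (1 - P₀ - 8 / K ^ 9) * (r - tz) := by
    intro r hr hrz
    have h := hinc r hr tz htz hrz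
    rw [hz, zero_sub] at h
    constructor <;> linarith [h.1, h.2]
  -- `Φ_s(r) = εs(r - tz)²/2` has `Φ_s' = εs(r - tz)`
  have hΦ : ∀ s r : ℝ,
      HasDerivAt (fun r => ε * s * ((r - tz) * (r - tz)) / 2) (ε * s * (r - tz)) r := by
    intro s r
    have h1 : HasDerivAt (fun r => r - tz) 1 r := (hasDerivAt_id r).sub_const tz
    exact (((h1.mul h1).const_mul (ε * s)).div_const 2).congr_deriv (by ring)
  refine ⟨?_, fun hzt => hafter t ht hzt, fun htz' => ?_⟩
  · rcases le_total tz t with hzt | htz'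
    · -- `t ≥ tz`: compare on `[tz, u]`
      have hsub : Icc tz u ⊆ Icc T u := Icc_subset_Icc_left htz.1
      have hm := Thm53.monotoneOn_sub_of_le_deriv (convex_Icc tz u) (fun r _ => hB r)
        (fun r _ => hΦ (1 - P₀ - 8 / K ^ 9) r) (fun r hr => (hafter r (hsub hr) hr.1).1)
      have ha := Thm53.antitoneOn_sub_of_deriv_le (convex_Icc tz u) (fun r _ => hB r)
        (fun r _ => hΦ (1 - P₀ + 6 / K ^ 9) r) (fun r hr => (hafter r (hsub hr) hr.1).2)
      have htI : t ∈ Icc tz u := ⟨hzt, ht.2⟩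
      have hzI : tz ∈ Icc tz u := left_mem_Icc.2 (hzt.trans ht.2)
      have h1 := hm hzI htI hzt
      have h2 := ha hzI htI hzt
      simp only [sub_self, mul_zero, zero_div, sub_zero] at h1 h2
      constructor <;> linarith [h1, h2]
    · -- `t ≤ tz`: compare on `[T, tz]`
      have hsub : Icc T tz ⊆ Icc T u := Icc_subset_Icc_right htz.2
      have ha := Thm53.antitoneOn_sub_of_deriv_le (convex_Icc T tz) (fun r _ => hB r)
        (fun r _ => hΦ (1 - P₀ - 8 / K ^ 9) r) (fun r hr => (hbefore r (hsub hr) hr.2).2)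
      have hm := Thm53.monotoneOn_sub_of_le_deriv (convex_Icc T tz) (fun r _ => hB r)
        (fun r _ => hΦ (1 - P₀ + 6 / K ^ 9) r) (fun r hr => (hbefore r (hsub hr) hr.2).1)
      have htI : t ∈ Icc T tz := ⟨ht.1, htz'⟩
      have hzI : tz ∈ Icc T tz := right_mem_Icc.2 (ht.1.trans htz')
      have h1 := ha htI hzI htz'
      have h2 := hm htI hzI htz'
      simp only [sub_self, mul_zero, zero_div, sub_zero] at h1 h2
      constructor <;> linarith [h1, h2]
  · have h := (hbefore t ht htz').2
    nlinarith [h, mul_nonneg (mul_nonneg hε.le hsl.le) (sub_nonneg.2 htz')]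

/-! ## §178 Quiet before the clock zero -/

/-- §178 QUIET BEFORE THE ZERO: under part 57 §172's hypotheses with `P₀ ≤ 1/2`, at any
`t ∈ [T, u]` with `b(t) ≤ 0` the trigger is `c(t) ≤ c(T) + 3σ` (`σ = ρ²e^{-K¹⁰}`): the clock is
`≤ 0` on `[T, t]`, the action is non-increasing there, so part 56 §170 applies with
`E = e^{μ(B(T) - B(t))}` and `E·e^{μ(B(t) - B(T))} = 1`. [derived: this file §178] -/
theorem knob_cold_quiet
    (hX : ∀ t, HasDerivAt X (RotorKnob.rotorCircuit K (K ^ 10) ε ρ (X t)) t)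
    (h0 : X 0 = delayInit) (hK : 16 ≤ K) (hε : 0 < ε) (hεK : ε ^ 2 ≤ 1 / (6 * K ^ 20))
    (hρ : 0 < ρ) (hhi : K ^ 10 * ρ ^ 2 ≤ 2 * ε) {T u θ P₀ : ℝ} (hT : 0 ≤ T)
    (hu : u ≤ T + 3) (hθ : 0 ≤ θ) (hθ2 : θ ≤ 3 / 2) (hbT : X T 1 = -(θ * ε))
    (hP : X T 3 ^ 2 + X T 4 ^ 2 = P₀) (hc : ∀ t ∈ Icc T u, X t 2 ≤ ρ ^ 2 / K ^ 9)
    (hP0 : P₀ ≤ 1 / 2) {B : ℝ → ℝ} (hB : ∀ t, HasDerivAt B (X t 1) t) {t : ℝ}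
    (ht : t ∈ Icc T u) (hbt : X t 1 ≤ 0) :
    X t 2 ≤ X T 2 + 3 * (ρ ^ 2 * exp (-K ^ 10)) := by
  have hK0 : (0 : ℝ) < K := by linarith
  have hmono := knob_cold_clock_mono hX h0 hK hε hεK hρ hhi hT hu hθ hθ2 hbT hP hc hP0
  have hXf := hX
  rw [RotorKnob.rotorCircuit_eq_fiveGate] at hXf
  have hσ : (0 : ℝ) ≤ ρ ^ 2 * exp (-K ^ 10) := by positivity
  have hμ : (0 : ℝ) ≤ ε⁻¹ * K ^ 10 := by positivity
  -- `b ≤ 0` on `[T, t]`, so the action is non-increasing there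
  have hb0 : ∀ r ∈ Icc T t, X r 1 ≤ 0 := fun r hr =>
    (hmono.monotoneOn ⟨hr.1, hr.2.trans ht.2⟩ ht hr.2).trans hbt
  have hanti : AntitoneOn B (Icc T t) :=
    antitoneOn_of_deriv_nonpos (convex_Icc T t)
      (fun r _ => (hB r).continuousAt.continuousWithinAt)
      (fun r _ => (hB r).differentiableAt.differentiableWithinAt)
      fun r hr => by rw [(hB r).deriv]; exact hb0 r (interior_subset hr)
  have hBt : ∀ τ ∈ Icc T t, B t ≤ B τ := fun τ hτ => hanti hτ (right_mem_Icc.2 ht.1) hτ.2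
  have hE : ∀ τ ∈ Icc T t,
      exp (-(ε⁻¹ * K ^ 10 * (B τ - B T))) ≤ exp (ε⁻¹ * K ^ 10 * (B T - B t)) := by
    intro τ hτ
    refine Real.exp_le_exp.2 ?_
    nlinarith [mul_le_mul_of_nonneg_left (hBt τ hτ) hμ]
  have hdebt := trigger_debt hXf h0 hσ hB hE (right_mem_Icc.2 ht.1)
  have hexp1 : exp (ε⁻¹ * K ^ 10 * (B t - B T)) ≤ 1 :=
    Real.exp_le_one_iff.2
      (by nlinarith [mul_le_mul_of_nonneg_left (hBt T (left_mem_Icc.2 ht.1)) hμ])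
  have hprod : exp (ε⁻¹ * K ^ 10 * (B T - B t)) * exp (ε⁻¹ * K ^ 10 * (B t - B T)) = 1 := by
    rw [← Real.exp_add, show ε⁻¹ * K ^ 10 * (B T - B t) + ε⁻¹ * K ^ 10 * (B t - B T) = 0 by
      ring, Real.exp_zero]
  have hcT0 : 0 ≤ X T 2 := c_nonneg hXf h0 hσ hT
  have htT : t - T ≤ 3 := by linarith [ht.2]
  have h1 := mul_le_mul_of_nonneg_left hexp1 hcT0
  have h2 := mul_le_mul_of_nonneg_left htT hσ
  calc X t 2 ≤ _ := hdebt
    _ = X T 2 * exp (ε⁻¹ * K ^ 10 * (B t - B T)) + ρ ^ 2 * exp (-K ^ 10) * (t - T)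
          * (exp (ε⁻¹ * K ^ 10 * (B T - B t)) * exp (ε⁻¹ * K ^ 10 * (B t - B T))) := by ring
    _ ≤ X T 2 + 3 * (ρ ^ 2 * exp (-K ^ 10)) := by rw [hprod, mul_one]; linarith

/-! ## §179 Quiet after the clock zero while the debt is unpaid -/

/-- §179 QUIET AFTER THE ZERO WHILE IN DEBT: under part 57 §172's hypotheses with `P₀ ≤ 1/2` and
the clock zero `tz ∈ [T, u]`, at any `t ∈ [T, u]` with `B(t) ≤ B(T)` (debt unpaid) and
`s_u(t - tz)²/2 ≤ 1 - 10 log K/K¹⁰` (seed not yet amplified past `3ρ²/K¹⁰`) the trigger is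
`c(t) ≤ c(T) + 3ρ²/K¹⁰`: part 56 §170 with `E = e^{μ(B(T) - B(tz))}` (`B ≥ B(tz)` on `[T, u]` by
§177), `μ·εs_u(t - tz)²/2 ≤ K¹⁰ - 10 log K` and `3σe^{K¹⁰ - 10 log K} = 3ρ²/K¹⁰`.
[derived: this file §179] -/
theorem knob_cold_quiet_seed
    (hX : ∀ t, HasDerivAt X (RotorKnob.rotorCircuit K (K ^ 10) ε ρ (X t)) t)
    (h0 : X 0 = delayInit) (hK : 16 ≤ K) (hε : 0 < ε) (hεK : ε ^ 2 ≤ 1 / (6 * K ^ 20))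
    (hρ : 0 < ρ) (hhi : K ^ 10 * ρ ^ 2 ≤ 2 * ε) {T u θ P₀ : ℝ} (hT : 0 ≤ T)
    (hu : u ≤ T + 3) (hθ : 0 ≤ θ) (hθ2 : θ ≤ 3 / 2) (hbT : X T 1 = -(θ * ε))
    (hP : X T 3 ^ 2 + X T 4 ^ 2 = P₀) (hc : ∀ t ∈ Icc T u, X t 2 ≤ ρ ^ 2 / K ^ 9)
    (hP0 : P₀ ≤ 1 / 2) {B : ℝ → ℝ} (hB : ∀ t, HasDerivAt B (X t 1) t) {tz : ℝ}
    (htz : tz ∈ Icc T u) (hz : X tz 1 = 0) {t : ℝ} (ht : t ∈ Icc T u) (hBt : B t ≤ B T)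
    (hw : (1 - P₀ + 6 / K ^ 9) * (t - tz) ^ 2 / 2 ≤ 1 - 10 * log K / K ^ 10) :
    X t 2 ≤ X T 2 + 3 * ρ ^ 2 / K ^ 10 := by
  have hK0 : (0 : ℝ) < K := by linarith
  have hK10 : (0 : ℝ) < K ^ 10 := by positivity
  have hsl := (cold_slopes hK hP0).2.2.2
  have hza := fun r (hr : r ∈ Icc T u) =>
    (knob_cold_zero_action hX h0 hK hε hεK hρ hhi hT hu hθ hθ2 hbT hP hc hP0 hB htz hz hr).1
  have hXf := hX
  rw [RotorKnob.rotorCircuit_eq_fiveGate] at hXf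
  have hσ : (0 : ℝ) ≤ ρ ^ 2 * exp (-K ^ 10) := by positivity
  have hμ : (0 : ℝ) ≤ ε⁻¹ * K ^ 10 := by positivity
  -- `B ≥ B(tz)` on `[T, u]`, so `E = e^{μ(B(T) - B(tz))}` serves on `[T, t]`
  have hBz : ∀ τ ∈ Icc T u, B tz ≤ B τ := fun τ hτ => by
    nlinarith [(hza τ hτ).1, mul_nonneg (mul_nonneg hε.le hsl.le) (sq_nonneg (τ - tz))]
  have hE : ∀ τ ∈ Icc T t,
      exp (-(ε⁻¹ * K ^ 10 * (B τ - B T))) ≤ exp (ε⁻¹ * K ^ 10 * (B T - B tz)) := by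
    intro τ hτ
    refine Real.exp_le_exp.2 ?_
    nlinarith [mul_le_mul_of_nonneg_left (hBz τ ⟨hτ.1, hτ.2.trans ht.2⟩) hμ]
  have hdebt := trigger_debt hXf h0 hσ hB hE (right_mem_Icc.2 ht.1)
  have hprod : exp (ε⁻¹ * K ^ 10 * (B T - B tz)) * exp (ε⁻¹ * K ^ 10 * (B t - B T))
      = exp (ε⁻¹ * K ^ 10 * (B t - B tz)) := by
    rw [← Real.exp_add]; congr 1; ring
  have hexp1 : exp (ε⁻¹ * K ^ 10 * (B t - B T)) ≤ 1 :=
    Real.exp_le_one_iff.2 (by nlinarith [mul_le_mul_of_nonneg_left hBt hμ])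
  -- `μ(B(t) - B(tz)) ≤ K¹⁰·s_u(t - tz)²/2 ≤ K¹⁰ - 10 log K`
  have hup : ε⁻¹ * K ^ 10 * (B t - B tz) ≤ K ^ 10 - 10 * log K := by
    have h1 : ε⁻¹ * K ^ 10 * (B t - B tz)
        ≤ ε⁻¹ * K ^ 10 * (ε * (1 - P₀ + 6 / K ^ 9) * (t - tz) ^ 2 / 2) :=
      mul_le_mul_of_nonneg_left (hza t ht).2 hμ
    have e : ε⁻¹ * K ^ 10 * (ε * (1 - P₀ + 6 / K ^ 9) * (t - tz) ^ 2 / 2)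
        = K ^ 10 * ((1 - P₀ + 6 / K ^ 9) * (t - tz) ^ 2 / 2) := by
      field_simp
    have h2 : K ^ 10 * ((1 - P₀ + 6 / K ^ 9) * (t - tz) ^ 2 / 2)
        ≤ K ^ 10 * (1 - 10 * log K / K ^ 10) := mul_le_mul_of_nonneg_left hw hK10.le
    have e2 : K ^ 10 * (1 - 10 * log K / K ^ 10) = K ^ 10 - 10 * log K := by
      field_simp
    linarith [h1, e, h2, e2]
  have hKlog : exp (10 * log K) = K ^ 10 := by
    rw [show (10 : ℝ) * log K = log (K ^ 10) by rw [Real.log_pow]; norm_num,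
      Real.exp_log hK10]
  have hexp2 : exp (ε⁻¹ * K ^ 10 * (B t - B tz)) ≤ exp (K ^ 10) / K ^ 10 := by
    calc exp (ε⁻¹ * K ^ 10 * (B t - B tz))
        ≤ exp (K ^ 10 - 10 * log K) := Real.exp_le_exp.2 hup
      _ = exp (K ^ 10) / K ^ 10 := by rw [Real.exp_sub, hKlog]
  have hee : exp (-K ^ 10) * exp (K ^ 10) = 1 := by
    rw [← Real.exp_add, neg_add_cancel, Real.exp_zero]
  have hcT0 : 0 ≤ X T 2 := c_nonneg hXf h0 hσ hT
  have htT : t - T ≤ 3 := by linarith [ht.2]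
  have h1 := mul_le_mul_of_nonneg_left hexp1 hcT0
  have h2 : ρ ^ 2 * exp (-K ^ 10) * (t - T) * exp (ε⁻¹ * K ^ 10 * (B t - B tz))
      ≤ ρ ^ 2 * exp (-K ^ 10) * 3 * (exp (K ^ 10) / K ^ 10) :=
    mul_le_mul (mul_le_mul_of_nonneg_left htT hσ) hexp2 (exp_pos _).le (by positivity)
  calc X t 2 ≤ _ := hdebt
    _ = X T 2 * exp (ε⁻¹ * K ^ 10 * (B t - B T)) + ρ ^ 2 * exp (-K ^ 10) * (t - T)
          * (exp (ε⁻¹ * K ^ 10 * (B T - B tz)) * exp (ε⁻¹ * K ^ 10 * (B t - B T))) := by ring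
    _ ≤ X T 2 * 1 + ρ ^ 2 * exp (-K ^ 10) * 3 * (exp (K ^ 10) / K ^ 10) := by
          rw [hprod]; linarith
    _ = X T 2 + 3 * ρ ^ 2 / K ^ 10 * (exp (-K ^ 10) * exp (K ^ 10)) := by ring
    _ = X T 2 + 3 * ρ ^ 2 / K ^ 10 := by rw [hee, mul_one]

end Summit.NavierStokesRegularity.FluidComputer.GateBudget
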